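import Summits.CriticalPhenomena.CardyFormulaZ2.Theorems.CardyBoundaryCoulombGasBoundaryDefectGaussianRStubTransportPathsPart18

/-!
# Stub `stub_transportPaths` of line `rainbow-monomials-in-excursion-kernels` — Part 28:
# separation of two rail points from the distance of boundary points
# (crux `CardyBoundaryCoulombGas.BoundaryDefectGaussianR`, stmt-CriticalPhenomena-14132)

* `tp_same_edge_dist` — two points of one edge are at distance the difference of their
  along-coordinates;
* `tp_sep_symm` — the separation clause of TRANSPORT is symmetric;
* `tp_sep_rail_points` — two rail points (edges `z`, `z'`, along-coordinates `δ x - A z`,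
  `δ x' - A z'` inside the edges) are separated (both ways) as soon as every pair of boundary
  points with these along-coordinates is at distance `≥ r + 2 δ` (feet within `δ` of the mesh
  points, Part 18).
All [folklore].
-/

noncomputable section

open Set Filter Metric Topology
open Literature.Probability.RandomPlanarGeometry
open Literature.Probability.LatticeModels Literature.Probability.LatticeModels.CollarLegModel
open Summit.CriticalPhenomena.CardyFormulaZ2.Cruxes.RectilinearCardy.ExcursionKernelCovariance

namespace Summit.CriticalPhenomena.CardyFormulaZ2.Cruxes.BoundaryDefectGaussianR.RainbowMonomialsInExcursionKernels

/-- **Two points of one edge** are at distance `|s₁ - s₂|` (difference of along-coordinates).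
[folklore] -/
theorem tp_same_edge_dist (D : JordanDomain) {c : ℤ → ℝ} {a : ℤ → ℕ}
    (hdir : ∀ z, ∀ t ∈ Icc (c z) (c (z + 1)), D.boundary t =
      D.boundary (c z) + ((‖D.boundary t - D.boundary (c z)‖ : ℝ) : ℂ) * Complex.I ^ (a z))
    (z : ℤ) {t₁ t₂ : ℝ} (ht₁ : t₁ ∈ Icc (c z) (c (z + 1))) (ht₂ : t₂ ∈ Icc (c z) (c (z + 1))) :
    dist (D.boundary t₁) (D.boundary t₂) =
      |‖D.boundary t₁ - D.boundary (c z)‖ - ‖D.boundary t₂ - D.boundary (c z)‖| := by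
  have h1 := hdir z t₁ ht₁
  have h2 := hdir z t₂ ht₂
  set s₁ := ‖D.boundary t₁ - D.boundary (c z)‖
  set s₂ := ‖D.boundary t₂ - D.boundary (c z)‖
  have e : D.boundary t₁ - D.boundary t₂ = (((s₁ - s₂ : ℝ)) : ℂ) * Complex.I ^ (a z) := by
    rw [h1, h2]; push_cast; ring
  rw [dist_eq_norm, e, norm_mul, norm_pow, Complex.norm_I, one_pow, mul_one, Complex.norm_real,
    Real.norm_eq_abs]

/-- The separation clause is symmetric. [folklore] -/
theorem tp_sep_symm {R : ℝ} (u v : ℤ × ℤ)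
    (h : R ≤ (((u.1 - v.1) ^ 2 + (u.2 - v.2) ^ 2 : ℤ) : ℝ)) :
    R ≤ (((v.1 - u.1) ^ 2 + (v.2 - u.2) ^ 2 : ℤ) : ℝ) := by
  have e : (v.1 - u.1) ^ 2 + (v.2 - u.2) ^ 2 = (u.1 - v.1) ^ 2 + (u.2 - v.2) ^ 2 := by ring
  rw [e]; exact h

/-- **Separation of two rail points from the distance of boundary points.** See the module
docstring. [folklore] -/
theorem tp_sep_rail_points (D : JordanDomain) {c : ℤ → ℝ} {a : ℤ → ℕ} (hcmono : StrictMono c)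
    (ha4 : ∀ z, a z < 4)
    (hdir : ∀ z, ∀ t ∈ Icc (c z) (c (z + 1)), D.boundary t =
      D.boundary (c z) + ((‖D.boundary t - D.boundary (c z)‖ : ℝ) : ℂ) * Complex.I ^ (a z))
    {δ r : ℝ} (hδ : 0 < δ) (hr : 0 ≤ r) (z x z' x' : ℤ)
    (h0 : 0 ≤ δ * x - (D.boundary (c z) * (-Complex.I) ^ (a z)).re)
    (h1 : δ * x - (D.boundary (c z) * (-Complex.I) ^ (a z)).re ≤
      ‖D.boundary (c (z + 1)) - D.boundary (c z)‖)
    (h0' : 0 ≤ δ * x' - (D.boundary (c z') * (-Complex.I) ^ (a z')).re)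
    (h1' : δ * x' - (D.boundary (c z') * (-Complex.I) ^ (a z')).re ≤
      ‖D.boundary (c (z' + 1)) - D.boundary (c z')‖)
    (hfar : ∀ t ∈ Icc (c z) (c (z + 1)), ∀ t' ∈ Icc (c z') (c (z' + 1)),
      ‖D.boundary t - D.boundary (c z)‖ = δ * x - (D.boundary (c z) * (-Complex.I) ^ (a z)).re →
      ‖D.boundary t' - D.boundary (c z')‖ =
        δ * x' - (D.boundary (c z') * (-Complex.I) ^ (a z')).re →
      r + 2 * δ ≤ dist (D.boundary t) (D.boundary t')) :
    (r / δ) ^ 2 ≤ (((((x • dir (Fin.ofNat 4 (a z)) +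
        ⌈(D.boundary (c z) * (-Complex.I) ^ (a z)).im / δ⌉ • dir (Fin.ofNat 4 (a z) + 1)).1 -
        (x' • dir (Fin.ofNat 4 (a z')) +
        ⌈(D.boundary (c z') * (-Complex.I) ^ (a z')).im / δ⌉ • dir (Fin.ofNat 4 (a z') + 1)).1) ^ 2 +
      ((x • dir (Fin.ofNat 4 (a z)) +
        ⌈(D.boundary (c z) * (-Complex.I) ^ (a z)).im / δ⌉ • dir (Fin.ofNat 4 (a z) + 1)).2 -
        (x' • dir (Fin.ofNat 4 (a z')) +
        ⌈(D.boundary (c z') * (-Complex.I) ^ (a z')).im / δ⌉ • dir (Fin.ofNat 4 (a z') + 1)).2) ^ 2 :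
          ℤ) : ℝ)) ∧
    (r / δ) ^ 2 ≤ (((((x' • dir (Fin.ofNat 4 (a z')) +
        ⌈(D.boundary (c z') * (-Complex.I) ^ (a z')).im / δ⌉ • dir (Fin.ofNat 4 (a z') + 1)).1 -
        (x • dir (Fin.ofNat 4 (a z)) +
        ⌈(D.boundary (c z) * (-Complex.I) ^ (a z)).im / δ⌉ • dir (Fin.ofNat 4 (a z) + 1)).1) ^ 2 +
      ((x' • dir (Fin.ofNat 4 (a z')) +
        ⌈(D.boundary (c z') * (-Complex.I) ^ (a z')).im / δ⌉ • dir (Fin.ofNat 4 (a z') + 1)).2 -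
        (x • dir (Fin.ofNat 4 (a z)) +
        ⌈(D.boundary (c z) * (-Complex.I) ^ (a z)).im / δ⌉ • dir (Fin.ofNat 4 (a z) + 1)).2) ^ 2 :
          ℤ) : ℝ)) := by
  obtain ⟨hq, t, ht, hγt, hnt, -⟩ := tp_rail_foot D hcmono ha4 hdir hδ z x h0 h1
  obtain ⟨hq', t', ht', hγt', hnt', -⟩ := tp_rail_foot D hcmono ha4 hdir hδ z' x' h0' h1'
  rw [← hγt] at hq
  rw [← hγt'] at hq'
  have hd := hfar t ht t' ht' hnt hnt'
  have h := tp_sep_of_dist hδ hr _ _ _ _ hq hq' hd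
  exact ⟨h, tp_sep_symm _ _ h⟩

/-- **Registered sub-goal `s7_sameEdgeDist` of stub `stub_transportPaths`** (distance of two points of
one edge, one-line form of `tp_same_edge_dist`). [folklore] -/
theorem s7_sameEdgeDist : ∀ (D : Literature.Probability.RandomPlanarGeometry.JordanDomain) (c : ℤ → ℝ) (a : ℤ → ℕ), (∀ z, ∀ t ∈ Set.Icc (c z) (c (z + 1)), D.boundary t = D.boundary (c z) + ((‖D.boundary t - D.boundary (c z)‖ : ℝ) : ℂ) * Complex.I ^ (a z)) → ∀ (z : ℤ) (t₁ t₂ : ℝ), (t₁ ∈ Set.Icc (c z) (c (z + 1))) → (t₂ ∈ Set.Icc (c z) (c (z + 1))) → dist (D.boundary t₁) (D.boundary t₂) = |‖D.boundary t₁ - D.boundary (c z)‖ - ‖D.boundary t₂ - D.boundary (c z)‖| :=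
  fun D _ _ hdir z _ _ ht₁ ht₂ => tp_same_edge_dist D hdir z ht₁ ht₂

end Summit.CriticalPhenomena.CardyFormulaZ2.Cruxes.BoundaryDefectGaussianR.RainbowMonomialsInExcursionKernels

end
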